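import Literature.AnabelianGeometry.EtaleTheta.DivisorMonoidsOfBaseFieldHull
import Literature.AnabelianGeometry.EtaleTheta.DivisorMonoidsRootLaw
import Mathlib.FieldTheory.Galois.Infinite
import HarnessLib

/-!
# [EtTh] Def. 3.1 (ii) ERRATUM E2 / Prop. 4.2 (iii): the covering ROOT LAW `DivisorMonoids.RootLaw` HOLDS for the base-field-theoretic
# hull — every constant acquires an `N`-th root over a deeper covering (genuine Kummer theory of `ℚ̄_p`; PROOF-ONLY)

S. Mochizuki, *The étale theta function …*, Publ. RIMS **45** (2009) [MochizukiEtTh2009], Def. 3.1 (ii) p.296 (PDF p.70) with ERRATUM E2 =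
[IUTchI] Rmk. 3.2.4 (i)(a) («for every `N ∈ ℕ_{≥1}`, `f` admits an `N`-th root over some tempered covering»), Def. 3.3 (iii) p.299 (PDF p.73)
(`B₀ : D₀ → Mon`), Prop. 4.2 (iii) proof p.315 (PDF p.89) («admits an `N`-th root over some tempered covering»).
[cite: MochizukiEtTh2009, Def 3.3 (iii) p.299 (PDF p.73); Prop 4.2 (iii) p.315 (PDF p.89)]

abc-iut cell, layer L2, seat abc-iut-L2-d3 (gen 10); L2-lead ruling R1112 «CONST-DICT CARRIER = C^{bs-fld} HULL OVER THE GENUINE BASE», junction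
step (c) input.  PROOF-ONLY (0 definitions, no `Prop`-valued definition, no instance, no notation, no sorry; nothing landed is edited) over this
lineage's Def. 3.3 (iii) datum `DivisorMonoids.bsFldHull p a ha` (p500605: `B₀(U) = Hom_Γ(Γ/U, ℚ̄_p^×) ≅ K_U^×` over `CosetCat Γ`) and abc-iut-L2-t3's
class-(c) binder `DivisorMonoids.RootLaw` (`DivisorMonoidsRootLaw.lean`, p447… lineage; E2 (a) read on the data):
* **`DivisorMonoids.rootLaw_bsFldHull`** — for EVERY topological group `Γ` and EVERY CONTINUOUS `a : Γ → G_{ℚ_p}` with open images, the hull's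
  data SATISFY THE ROOT LAW: a constant `c ∈ K_U^×` of the covering `Γ/U` (function component of `b ∈ B₀(U)`) has an `N`-th root among the
  constants of the deeper covering `Γ/V → Γ/U`, `V := U ∩ a⁻¹(Gal(ℚ̄_p/ℚ_p(c^{1/N})))` — OPEN because `ℚ_p(c^{1/N})/ℚ_p` is finite (Krull topology,
  Mathlib `IntermediateField.fixingSubgroup_isOpen`) and `a` is continuous; the root `c^{1/N}` exists in the algebraically closed `ℚ̄_p` and is
  FIXED by `a(V)`, so it is a constant of `Γ/V` (`BsFldHull.ofFixed`); the identity `r^N = B₀(f)(b)` is checked at the base point (`ev_injective`,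
  `ev_pullFun`).  This is the E2 covering clause in its GENUINE arithmetic form (Kummer coverings of the base field), in contrast with the
  one-covering `G`-set models where it forces `B₀ = 1` (abc-iut-L2-t3's `bZero_eq_one_of_rootLaw_ofGaloisActionConnected`).
CONSUMERS: abc-iut-L2-t3's transfers `TemperedFrobenioid.baseRootLaw_of_rootLaw` / `CosetCat.hLift_galois_of_full_essSurj` give the §4 binder A10
`BaseRootLaw «Galois»` for this lineage's hull `BsFldHull.temperedFrobenioid` (base = the equivalence inverse), whence abc-iut-w4-d044's `hR` of the
Prop. 4.2 (iii) pipeline (`rootLaw_of_baseRootLaw'`) — the `N`-th-root objects `B_N` of the §5 junction at the hull.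
HONEST FRAMING: classical Kummer theory of `ℚ̄_p/ℚ_p` at a carrier with degenerate divisor geometry; nothing of [EtTh] is asserted; nothing
here bears on [IUTchIII] Cor. 3.12; no side taken; typed ≠ proved elsewhere.
-/

noncomputable section

namespace Literature.AnabelianGeometry.EtaleTheta

open CategoryTheory Opposite Literature.AlgebraicGeometry.Frobenioids Literature.AnabelianGeometry.SemiGraphs

namespace BsFldHull

variable (p : ℕ) [Fact p.Prime] {Γ : Type} [Group Γ] [TopologicalSpace Γ] (a : Γ →* GQp p)
  (ha : ∀ U : OpenSubgroup Γ, IsOpen ((U.toSubgroup.map a : Subgroup (GQp p)) : Set (GQp p)))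

/-- **The Kummer covering of `Γ/U` trivialising `z`**: for `z ∈ ℚ̄_p` (algebraic over `ℚ_p`), the open subgroup
`V := U ∩ a⁻¹(Gal(ℚ̄_p/ℚ_p(z)))` — open since `ℚ_p(z)/ℚ_p` is finite and `a` is continuous.  [cite: MochizukiEtTh2009, Prop 4.2 (iii) p.315 (PDF p.89)] -/
theorem isOpen_inf_comap_fixingSubgroup_adjoin (hcont : Continuous a) (U : OpenSubgroup Γ) (z : PadicAlgCl p) :
    IsOpen (((U : Subgroup Γ) ⊓ ((IntermediateField.adjoin ℚ_[p] ({z} : Set (PadicAlgCl p))).fixingSubgroup.comap a) : Subgroup Γ) : Set Γ) := by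
  haveI : FiniteDimensional ℚ_[p] (IntermediateField.adjoin ℚ_[p] ({z} : Set (PadicAlgCl p))) :=
    IntermediateField.adjoin.finiteDimensional (Algebra.IsAlgebraic.isAlgebraic z).isIntegral
  have hopen : IsOpen (((IntermediateField.adjoin ℚ_[p] ({z} : Set (PadicAlgCl p))).fixingSubgroup : Subgroup (GQp p)) : Set (GQp p)) :=
    IntermediateField.fixingSubgroup_isOpen _
  exact IsOpen.inter U.isOpen (hopen.preimage hcont)

/-- **E2 (a) `RootLaw` HOLDS for the base-field-theoretic hull** (continuous `a`): every `b ∈ B₀(U)` has, for every `N ≥ 1`, an `N`-th root in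
`B₀(V)` over the Kummer covering `Γ/V → Γ/U`, `V = U ∩ a⁻¹(Gal(ℚ̄_p/ℚ_p(c^{1/N})))`, `c = b(1·U)`.
[cite: MochizukiEtTh2009, Def 3.3 (iii) p.299 (PDF p.73); Prop 4.2 (iii) p.315 (PDF p.89)] -/
theorem _root_.Literature.AnabelianGeometry.EtaleTheta.DivisorMonoids.rootLaw_bsFldHull (hcont : Continuous a) :
    (DivisorMonoids.bsFldHull p a ha).RootLaw := by
  refine ⟨fun N U b => ?_⟩
  -- the constant `c` of `Γ/U` and an `N`-th root `z` of it in `ℚ̄_p`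
  obtain ⟨z, hz⟩ := IsAlgClosed.exists_pow_nat_eq (((ev p a U b : (PadicAlgCl p)ˣ) : PadicAlgCl p)) N.pos
  have hz0 : z ≠ 0 := by
    intro h
    rw [h, zero_pow N.ne_zero] at hz
    exact (ev p a U b).ne_zero hz.symm
  -- the Kummer covering `V := U ∩ a⁻¹(G_{ℚ_p(z)})`
  let L : IntermediateField ℚ_[p] (PadicAlgCl p) := IntermediateField.adjoin ℚ_[p] ({z} : Set (PadicAlgCl p))
  let V : OpenSubgroup Γ := ⟨(U.sg : Subgroup Γ) ⊓ (L.fixingSubgroup.comap a), isOpen_inf_comap_fixingSubgroup_adjoin p a hcont U.sg z⟩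
  have hVU : ∀ v ∈ V, v ∈ U.sg := fun v hv => hv.1
  have hVz : ∀ v ∈ V, a v z = z := fun v hv =>
    (IntermediateField.mem_fixingSubgroup_iff _ _).mp hv.2 z (IntermediateField.subset_adjoin ℚ_[p] _ (Set.mem_singleton z))
  -- the covering map `Γ/V → Γ/U`, `gV ↦ gU`
  let f : (⟨V⟩ : CosetCat Γ) ⟶ U := CosetCat.homMk ((1 : Γ) : U.carrier) fun v hv => by
    rw [MulAction.Quotient.smul_coe, smul_eq_mul, mul_one, QuotientGroup.eq, mul_one, inv_mem_iff]
    exact hVU v hv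
  -- the root: the constant `z` of `Γ/V`
  have hzmem : ((Units.mk0 z hz0 : (PadicAlgCl p)ˣ) : PadicAlgCl p) ∈ fixFld p a (⟨V⟩ : CosetCat Γ).sg := by
    rw [Units.val_mk0, mem_fixFld_iff]
    exact hVz
  refine ⟨⟨V⟩, f, ofFixed p a ⟨V⟩ (Units.mk0 z hz0) hzmem, ?_⟩
  -- check at the base point
  apply ev_injective p a
  change ev p a _ (ofFixed p a ⟨V⟩ (Units.mk0 z hz0) hzmem ^ (N : ℕ)) = ev p a _ (pullFun p a f b)
  rw [map_pow, ev_ofFixed, ev_pullFun p a f b (CosetCat.pt_homMk _ _)]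
  apply Units.ext
  rw [Units.val_pow_eq_pow_val, Units.val_mk0, hz, map_one, one_smul]

end BsFldHull

end Literature.AnabelianGeometry.EtaleTheta

end
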